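import Summits.AtomisticToContinuum.BoseEinsteinCondensation.Theses.BECConjugateDomination
import Literature.MathematicalPhysics.QuantumManyBody.PeriodicBoseGasThm31
import Literature.MathematicalPhysics.QuantumManyBody.PeriodicBoseGasImpurityTranslation
import Literature.MathematicalPhysics.QuantumManyBody.BoseGasDirichletWall

/-!
# Line `sacrificial-edge-layer` — crux `BECConjugateDomination.PuffFloor`
(stmt-AtomisticToContinuum-11785) · skeleton, crux-plan gen 1 (round 1), re-audited by gen 2
(2026-08-16: `lean check` rc 0, 4 sorries = the 4 stubs, audit `proof-of-item PuffFloor_of →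
Theses.BECConjugateDomination.PuffFloor`; Lee 2009 §3 re-read at page level by this seat; stub
signatures UNCHANGED from gen 1 — only docstrings sharpened: uniformity of Lee's `c₁` in the torus
size (STUB 1), the explicit Puff constants `Θ = 12T/N + 2P/N` (STUB 2), the Lean cost and the
cheapest discharge of the regularity stub (STUB 3))

Idea card `Cruxes/PuffFloor/Ideas/sacrificial-edge-layer.md` (crux-ideate r1, ideator 1); triage
r1-1 pass · r1-2 pass · r1-3 fail-as-duplicate (merge with `coupling-slope-pocket`; the printed
input is Lee 2009 **Thm 7**, not Thm 3 / Yin 2010). This file is the CHECKED SKELETON of the line: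
four registered stubs `stub_*` (the only `sorry`s) and the sorry-free composition `PuffFloor_of`
concluding the route decl `Theses.BECConjugateDomination.PuffFloor` BY NAME.

**The crux** (fixed). For every smooth-class `v` (repulsive finite range, finite, `C²` as
`ṽ(x) = v(|x|)`, edge condition `‖D²ṽ‖ ≤ Cₑ√ṽ`): `∃ C ≥ 0, ρ₀ > 0` such that for `0 < ρ < ρ₀`, all
large `N = n+1` and every exact, finite-energy, real, nowhere-zero minimiser `Ψ` of the periodic
`N`-body energy on the torus of side `L = (N/ρ)^{1/3}`, for every mode `m ≠ 0` (`k = 2πm/L`):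
`S_m ≥ |k|/√(|k|² + Cρ)`.

**The line.** Units `ħ = 2m = 1`. Let `W(x) := |x|² ‖D²ṽ(x)‖` (Puff's pair weight, `puffWeight`),
`W^per` its periodisation and `P(Ψ) := E_Ψ[∑_{i<j} W^per(xᵢ - xⱼ)]` (`pairMoment`).
* Puff/Hölder/f-sum (`stub_cubicMomentFloor`, shared with every line on this crux and with the
  sibling `CurrentSumRule`): for a `C³` real exact minimiser, `S_m ≥ |k|/√(|k|² + c(E(Ψ)/N + P(Ψ)/N))`
  (`m₀ ≥ m₁^{3/2} m₃^{-1/2}`, `m₁ = N|k|²`, Puff's cubic moment `m₃ ≤ N|k|⁴(|k|² + c T/N + c P/N)`).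
* THE LEVER (one-sided Hellmann–Feynman chord, exact at the minimiser, proved here:
  `pairMomentBoundSolid_of`): for ANY observable `U ≥ 0`, `μ⟨U⟩_Ψ ≤ E₀(v) − inf spec(H(v) − μU)`.
  With `U = ∑ W^per` the pair moment of the minimiser is paid by a STABILITY statement for the gas
  whose pair potential `v − μW` is `v` with a thin shallow ATTRACTIVE layer glued on its soft edge:
  `stub_edgeLayerStability` (`μ ∑W^per ≤ H(v) + CρN` as forms, `0 < v 0`; TRUE with `C = 0` by
  Lee 2009 Thm 7 — positive core + classical stability of `v − λ1_{B_{R₀}}` by pigeonhole, Dyson at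
  `n = 2` in Neumann cells, superadditivity, sliding average — no support separation needed).
* `E₀ ≤ ρ N ∫ṽ` by the constant trial state (PROVED here: `periodicGroundStateEnergy_le_const`).
* Scope and regularity residuals made explicit (triage S1/S2 = F1/F2): `stub_corelessPairMoment`
  (the pair-moment node for the class members with `v 0 = 0`, where every energy-comparison lever
  is void — planted-cluster witness; expected TRUE, no mechanism in this line) and
  `stub_minimiserRegularity` (a `C¹` exact minimiser is `C³`: torus elliptic regularity, or
  uniqueness of the positive ground state + `PositiveMinimiser` stmt-11787).

Composition: `PuffFloor_of : PuffFloor` — case split on `0 < v 0`; `C := c·(∫ṽ + C_P)`, `ρ₀ := ρ_P`;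
monotonicity of `a/√(a² + x)` in `x`.

Disproof.lean (cdisprove v4, Targets: none) honoured: `puffFloor_false_without_minimality` — minimality is used
exactly twice: the HF chord needs `E(Ψ) = E₀` (`pairMomentBoundSolid_of`) and the Puff chain needs
the eigen-equation / `H − E₀ ≥ 0` (`stub_cubicMomentFloor`); `puffFloor_false_for_nearMinimisers` —
no stub argues by energy-closeness (stability is quantified over ALL states of the COMPARISON form,
the floor only at the exact minimiser); `puffFloor_tight_at_freeGas` — `v ≡ 0` has `v 0 = 0`, lands in
`stub_corelessPairMoment` with `W ≡ 0`, `P = 0`, consistent with `C = 0`. Targets: none. Negatives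
index (12): no contact (every constant `∃`-quantified with its sign, all claims under `∀ᶠ n`).
-/

noncomputable section

open MeasureTheory Filter Set Metric
open scoped ENNReal NNReal Topology BigOperators

namespace Summit.AtomisticToContinuum.BoseEinsteinCondensation.Cruxes.PuffFloor.SacrificialEdgeLayer

open Literature.MathematicalPhysics.QuantumManyBody.BoseGas

/-! ## Objects -/

/-- Puff's pair weight `W(x) = |x|² ‖D²ṽ(x)‖` (`ṽ(y) = v(|y|)` on `ℝ³`), as an `ℝ≥0∞`-valued weight
on separation VECTORS (no radiality lemma needed downstream). Bounded with support in `B̄_{R₀}` for a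
smooth-class `v`. -/
def puffWeight (v : ℝ → ℝ≥0∞) (x : Space) : ℝ≥0∞ :=
  ENNReal.ofReal (‖x‖ ^ 2 * ‖iteratedFDeriv ℝ 2 (fun y : Space => (v ‖y‖).toReal) x‖)

/-- Periodisation of a weight on vectors: `W^per(x) = ∑_{q ∈ ℤ³} W(x - Lq)`. -/
def periodizedWeight (W : Space → ℝ≥0∞) (L : ℝ) (x : Space) : ℝ≥0∞ :=
  ∑' q : Fin 3 → ℤ, W (x - latticeVec L q)

/-- `∑_{i<j} W^per(xᵢ - xⱼ)` of a configuration. -/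
def pairWeightSum {N : ℕ} (W : Space → ℝ≥0∞) (L : ℝ) (X : Config N) : ℝ≥0∞ :=
  ∑ i : Fin N, ∑ j : Fin N with i < j, periodizedWeight W L (X i - X j)

/-- Puff's PAIR MOMENT `P(ψ) = ∫_{cell^N} ∑_{i<j} W^per(xᵢ - xⱼ) |ψ|²` of an `N`-body amplitude on the
torus of side `L` (the quantity every line on this crux must show is `O(ρN)` for the minimiser). -/
def pairMoment (v : ℝ → ℝ≥0∞) (N : ℕ) (L : ℝ) (ψ : Config N → ℂ) : ℝ≥0∞ :=
  ∫⁻ X in cellN N L, pairWeightSum (puffWeight v) L X * (‖ψ X‖₊ : ℝ≥0∞) ^ 2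

/-- `|k| = ‖(2π/L) m‖` of the mode `m` (the crux's `let kn`). -/
def waveNorm (L : ℝ) (m : Fin 3 → ℤ) : ℝ :=
  ‖((2 * Real.pi / L) • latticeVec 1 m)‖

/-- The (uncentred) static structure factor `S_m = N⁻¹ ∫ |∑ⱼ e_m(xⱼ)|² |Ψ|²` (the crux's `let S`). -/
def structureFactor (n : ℕ) (L : ℝ) (Ψ : PeriodicTrialState (n + 1) L) (m : Fin 3 → ℤ) : ℝ :=
  ((n : ℝ) + 1)⁻¹ * ∫ X in cellN (n + 1) L, ‖∑ j : Fin (n + 1), cellWave L m (X j)‖ ^ 2 * ‖Ψ.ψ X‖ ^ 2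

/-! ## Frames and named statements (the stubs below are their inline, let-free forms) -/

/-- The quantifier frame of the crux over a predicate of `(v, C, ρ, n, Ψ)`: smooth class, `∃ C ρ₀`,
`∀ ρ < ρ₀`, eventually in `n`, every exact finite-energy real nowhere-zero minimiser. -/
def MinFrame
    (P : (ℝ → ℝ≥0∞) → ℝ → ∀ (ρ : ℝ) (n : ℕ), PeriodicTrialState (n + 1) (sideLength ρ (n + 1)) → Prop) :
    Prop :=
  ∀ v : ℝ → ℝ≥0∞, IsRepulsiveFiniteRange v → (∀ r, v r ≠ ⊤) →
    ContDiff ℝ 2 (fun x : Space => (v ‖x‖).toReal) →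
    (∃ Cₑ : ℝ, ∀ x : Space,
      ‖iteratedFDeriv ℝ 2 (fun x : Space => (v ‖x‖).toReal) x‖ ≤ Cₑ * Real.sqrt ((v ‖x‖).toReal)) →
    ∃ C : ℝ, 0 ≤ C ∧ ∃ ρ₀ : ℝ, 0 < ρ₀ ∧ ∀ ρ : ℝ, 0 < ρ → ρ < ρ₀ → ∀ᶠ n : ℕ in atTop,
      ∀ Ψ : PeriodicTrialState (n + 1) (sideLength ρ (n + 1)),
        periodicEnergy v Ψ = periodicGroundStateEnergy v (n + 1) (sideLength ρ (n + 1)) →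
        periodicEnergy v Ψ ≠ ⊤ → (∀ X, Ψ.ψ X = (‖Ψ.ψ X‖ : ℂ)) → (∀ X, Ψ.ψ X ≠ 0) → P v C ρ n Ψ

/-- **The crux, restated over the named objects** (definitionally the route decl:
`puffFloorNamed_iff : PuffFloorNamed ↔ PuffFloor := Iff.rfl`). -/
def PuffFloorNamed : Prop :=
  MinFrame fun _ C ρ n Ψ => ∀ m : Fin 3 → ℤ, m ≠ 0 →
    waveNorm (sideLength ρ (n + 1)) m / Real.sqrt (waveNorm (sideLength ρ (n + 1)) m ^ 2 + C * ρ) ≤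
      structureFactor n (sideLength ρ (n + 1)) Ψ m

/-- **Pair-moment bound** for the minimiser (the node Puff consumes): `P(Ψ) ≤ C ρ N`. -/
def PairMomentBound : Prop :=
  MinFrame fun v C ρ n Ψ =>
    pairMoment v (n + 1) (sideLength ρ (n + 1)) Ψ.ψ ≤ ENNReal.ofReal (C * ρ * ((n : ℝ) + 1))

/-- `PairMomentBound` restricted to SOLID cores `0 < v 0` (delivered by the lever of this line). -/
def PairMomentBoundSolid : Prop :=
  ∀ v : ℝ → ℝ≥0∞, IsRepulsiveFiniteRange v → (∀ r, v r ≠ ⊤) →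
    ContDiff ℝ 2 (fun x : Space => (v ‖x‖).toReal) →
    (∃ Cₑ : ℝ, ∀ x : Space,
      ‖iteratedFDeriv ℝ 2 (fun x : Space => (v ‖x‖).toReal) x‖ ≤ Cₑ * Real.sqrt ((v ‖x‖).toReal)) →
    0 < v 0 →
    ∃ C : ℝ, 0 ≤ C ∧ ∃ ρ₀ : ℝ, 0 < ρ₀ ∧ ∀ ρ : ℝ, 0 < ρ → ρ < ρ₀ → ∀ᶠ n : ℕ in atTop,
      ∀ Ψ : PeriodicTrialState (n + 1) (sideLength ρ (n + 1)),
        periodicEnergy v Ψ = periodicGroundStateEnergy v (n + 1) (sideLength ρ (n + 1)) →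
        periodicEnergy v Ψ ≠ ⊤ → (∀ X, Ψ.ψ X = (‖Ψ.ψ X‖ : ℂ)) → (∀ X, Ψ.ψ X ≠ 0) →
        pairMoment v (n + 1) (sideLength ρ (n + 1)) Ψ.ψ ≤ ENNReal.ofReal (C * ρ * ((n : ℝ) + 1))

/-- `PairMomentBound` restricted to CORELESS class members `v 0 = 0` (the residual, STUB 4). -/
def PairMomentBoundCoreless : Prop :=
  ∀ v : ℝ → ℝ≥0∞, IsRepulsiveFiniteRange v → (∀ r, v r ≠ ⊤) →
    ContDiff ℝ 2 (fun x : Space => (v ‖x‖).toReal) →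
    (∃ Cₑ : ℝ, ∀ x : Space,
      ‖iteratedFDeriv ℝ 2 (fun x : Space => (v ‖x‖).toReal) x‖ ≤ Cₑ * Real.sqrt ((v ‖x‖).toReal)) →
    v 0 = 0 →
    ∃ C : ℝ, 0 ≤ C ∧ ∃ ρ₀ : ℝ, 0 < ρ₀ ∧ ∀ ρ : ℝ, 0 < ρ → ρ < ρ₀ → ∀ᶠ n : ℕ in atTop,
      ∀ Ψ : PeriodicTrialState (n + 1) (sideLength ρ (n + 1)),
        periodicEnergy v Ψ = periodicGroundStateEnergy v (n + 1) (sideLength ρ (n + 1)) →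
        periodicEnergy v Ψ ≠ ⊤ → (∀ X, Ψ.ψ X = (‖Ψ.ψ X‖ : ℂ)) → (∀ X, Ψ.ψ X ≠ 0) →
        pairMoment v (n + 1) (sideLength ρ (n + 1)) Ψ.ψ ≤ ENNReal.ofReal (C * ρ * ((n : ℝ) + 1))

/-- **Edge-layer stability** (STUB 1, the lever's load-bearing input; solid cores): there is ONE
coupling `μ > 0` at which the gas with the sacrificial attractive edge layer `−μW^per` glued on does
not collapse below `−CρN` in the dilute torus limit — as quadratic forms on ALL periodic trial states,
`μ ⟨Φ, ∑_{i<j} W^per(xᵢ-xⱼ) Φ⟩ ≤ ⟨Φ, H(v) Φ⟩ + CρN`. -/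
def EdgeLayerStability : Prop :=
  ∀ v : ℝ → ℝ≥0∞, IsRepulsiveFiniteRange v → (∀ r, v r ≠ ⊤) →
    ContDiff ℝ 2 (fun x : Space => (v ‖x‖).toReal) →
    (∃ Cₑ : ℝ, ∀ x : Space,
      ‖iteratedFDeriv ℝ 2 (fun x : Space => (v ‖x‖).toReal) x‖ ≤ Cₑ * Real.sqrt ((v ‖x‖).toReal)) →
    0 < v 0 →
    ∃ μ : ℝ, 0 < μ ∧ ∃ C : ℝ, 0 ≤ C ∧ ∃ ρ₀ : ℝ, 0 < ρ₀ ∧ ∀ ρ : ℝ, 0 < ρ → ρ < ρ₀ →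
      ∀ᶠ n : ℕ in atTop, ∀ Φ : PeriodicTrialState (n + 1) (sideLength ρ (n + 1)),
        ENNReal.ofReal μ * pairMoment v (n + 1) (sideLength ρ (n + 1)) Φ.ψ ≤
          periodicEnergy v Φ + ENNReal.ofReal (C * ρ * ((n : ℝ) + 1))

/-- **Edge-layer domination** — the `ρ`-FREE form in which STUB 1 is expected to be proved
(Lee 2009 Thm 7 shape; NOT registered): one coupling `μ > 0` and one `L₀` such that
`μ ∑W^per ≤ H(v)` as forms for EVERY particle number on EVERY torus of side `≥ L₀`.
`edgeLayerStability_of_domination` derives STUB 1 from it (with `C = 0`, `ρ₀ = 1`). -/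
def EdgeLayerDomination : Prop :=
  ∀ v : ℝ → ℝ≥0∞, IsRepulsiveFiniteRange v → (∀ r, v r ≠ ⊤) →
    ContDiff ℝ 2 (fun x : Space => (v ‖x‖).toReal) →
    (∃ Cₑ : ℝ, ∀ x : Space,
      ‖iteratedFDeriv ℝ 2 (fun x : Space => (v ‖x‖).toReal) x‖ ≤ Cₑ * Real.sqrt ((v ‖x‖).toReal)) →
    0 < v 0 →
    ∃ μ : ℝ, 0 < μ ∧ ∃ L₀ : ℝ, ∀ (N : ℕ) (L : ℝ), L₀ ≤ L → ∀ Φ : PeriodicTrialState N L,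
      ENNReal.ofReal μ * pairMoment v N L Φ.ψ ≤ periodicEnergy v Φ

/-- **Minimiser regularity** (STUB 3): an exact minimiser in the `C¹` periodic Bose class is `C³`. -/
def MinimiserRegularity : Prop :=
  ∀ v : ℝ → ℝ≥0∞, IsRepulsiveFiniteRange v → (∀ r, v r ≠ ⊤) →
    ContDiff ℝ 2 (fun x : Space => (v ‖x‖).toReal) →
    (∃ Cₑ : ℝ, ∀ x : Space,
      ‖iteratedFDeriv ℝ 2 (fun x : Space => (v ‖x‖).toReal) x‖ ≤ Cₑ * Real.sqrt ((v ‖x‖).toReal)) →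
    ∀ (n : ℕ) (L : ℝ), 0 < L → ∀ Ψ : PeriodicTrialState (n + 1) L,
      periodicEnergy v Ψ = periodicGroundStateEnergy v (n + 1) L → periodicEnergy v Ψ ≠ ⊤ →
      (∀ X, Ψ.ψ X = (‖Ψ.ψ X‖ : ℂ)) → (∀ X, Ψ.ψ X ≠ 0) → ContDiff ℝ 3 Ψ.ψ

/-- **Cubic-moment floor** (STUB 2, the Puff/Hölder/f-sum chain at FINITE `N`, `L`): for a `C³` real
exact minimiser with finite pair moment, `S_m ≥ |k| / √(|k|² + c (E(Ψ)/N + P(Ψ)/N))` at every mode. -/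
def CubicMomentFloor : Prop :=
  ∀ v : ℝ → ℝ≥0∞, IsRepulsiveFiniteRange v → (∀ r, v r ≠ ⊤) →
    ContDiff ℝ 2 (fun x : Space => (v ‖x‖).toReal) →
    (∃ Cₑ : ℝ, ∀ x : Space,
      ‖iteratedFDeriv ℝ 2 (fun x : Space => (v ‖x‖).toReal) x‖ ≤ Cₑ * Real.sqrt ((v ‖x‖).toReal)) →
    ∃ c : ℝ, 0 ≤ c ∧ ∀ (n : ℕ) (L : ℝ), 0 < L → ∀ Ψ : PeriodicTrialState (n + 1) L,
      periodicEnergy v Ψ = periodicGroundStateEnergy v (n + 1) L → periodicEnergy v Ψ ≠ ⊤ →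
      ContDiff ℝ 3 Ψ.ψ → (∀ X, Ψ.ψ X = (‖Ψ.ψ X‖ : ℂ)) → pairMoment v (n + 1) L Ψ.ψ ≠ ⊤ →
      ∀ m : Fin 3 → ℤ, m ≠ 0 →
        waveNorm L m / Real.sqrt (waveNorm L m ^ 2 +
            c * ((periodicEnergy v Ψ).toReal / ((n : ℝ) + 1) +
              (pairMoment v (n + 1) L Ψ.ψ).toReal / ((n : ℝ) + 1))) ≤
          structureFactor n L Ψ m

/-! ## Registered stubs (the ONLY `sorry`s of the line)

Self-contained, LET-FREE signatures over tree declarations only (under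
`open Literature.MathematicalPhysics.QuantumManyBody.BoseGas`): `W^per`, `P`, `|k|`, `S_m` appear
expanded. Each is certified equal to the named statement above (`…_iff`, `Iff.rfl`). A stub worker
restates the signature verbatim in a `Theorems/` file. -/

/-- **STUB 1 (hardest of the line proper; size L–XL) — `EdgeLayerStability`.** For a smooth-class `v`
with a SOLID core `0 < v 0` there are `μ > 0`, `C ≥ 0`, `ρ₀ > 0` with: for `0 < ρ < ρ₀`, all large
`N = n+1` and EVERY periodic trial state `Φ` on the torus of side `L = (N/ρ)^{1/3}`,
`μ · ∫ ∑_{i<j} W^per(xᵢ-xⱼ)|Φ|² ≤ ⟨Φ,H(v)Φ⟩ + CρN`, `W(x) = |x|²‖D²ṽ(x)‖`.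
Why true: `W ≤ R₀²M₂·1_{B̄_{R₀}}` (`M₂ = sup‖D²ṽ‖`, `D²ṽ = 0` off `supp ṽ`); Lee 2009 (arXiv:0803.0533)
Thm 7 (p. 5: `E(n, 𝕋_{ℓ'}, V₁ − c₁V₂) ≥ 0` for any `n`) through its PROOF, Lemmas 9 and 11 (pp. 5–7),
which uses only: `V₁, V₂ ≥ 0` continuous compactly supported, `V₁(0) > 0`, `supp V₂ ⊂ B_{R₁}`,
classical stability `∑_{i<j}(V₁ − V₂)(xᵢ − xⱼ) ≥ −nB` (Def. 2, p. 3) — the support separation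
`V₂ = 0 on B_{R₀}` inherited from the hypotheses of Thm 3 is NEVER used (triage r1-1, r1-2 §C, r1-3,
page-level; re-read by the gen-2 planner, p0005 L88 – p0007 L32): Dyson's lemma at `n = 2` in
Neumann cells for the shifted core `V₁' = (V₁ − V₁(0)/2)1_{B_R}`, superadditivity for `V₁ ≥ 0`,
`E(k,S,V₁−V₂) ≥ −Bk`, `δ ≤ min{½, E'(ℓ)/6B}`, sliding average `h_ℓ ≥ 1 − √3R₁/ℓ`,
`c₁ = (1 − √3R₁/ℓ)δ(ℓ)`. UNIFORMITY IN THE TORUS SIZE (the point a stub worker must get right; Thm 7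
is printed as "for any `ℓ'` there is `c₁`"): Lee FIXES the cell `ℓ = max{10ℓ̃, 2R₁}` (p. 6), so `δ(ℓ)`
and `c₁` do not depend on `ℓ' ≥ ℓ`; his grid `G` silently needs `ℓ ∣ ℓ'` — for a general torus side
`L ≥ 2ℓ` take the cell `ℓ_L := L/⌊L/ℓ⌋ ∈ [ℓ, 2ℓ)`, which divides `L`, and note Lemma 9 holds on every
box with `δ` monotone through `E'(ℓ) = 3a'/((2ℓ)³ − R³)`: `δ(ℓ_L) ≥ δ(2ℓ) > 0`, whence one
`μ = (1 − √3R₁/ℓ)δ(2ℓ)λ/(R₀²M₂)` serves every `L ≥ 2ℓ` (nearest image: `L > 2R₁`). Classical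
stability of `v − λb` (`b` a radial bump, `1_{B̄_{R₀}} ≤ b ≤ 1_{B_{2R₀}}`, `R₁ = 2R₀`) for
`λ ≤ c₀/2K` by cube counting from the positive core (`c₀ = v(0)/2` on `B_{r₀}`, cubes of diameter
`r₀`, `#{pairs < 2R₀} ≤ 2KΣ_c C(n_c,2) + Kn`, `K = (2⌈2R₀√3/r₀⌉+1)³`; `B = λK`). Gives the stub with
`C = 0`, any `ρ₀` (`L_N → ∞`; `edgeLayerStability_of_domination`). FALSE without `0 < v 0` (hollow
core: four `N/4`-clusters at the vertices of a tetrahedron of side in the layer, `inf = −cμ²N²`;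
numerically confirmed by triage toy j009977). Leans on (tree, PROVED): `LSSY2005_dysonBound_boxN_holds`,
`sum_neumannGroundStateEnergy_mul_le_setLIntegral_cellSet`, `LSSY2005_cellDecomposition_holds`,
`LSSY2005_superadditivity_holds`, `PeriodicTrialState.toNeumann`, `neumannPoincare_boxN_holds`;
Lee's inf is over ALL `ψ` (no Bose symmetry, p. 3), hence bounds our symmetric class from below. -/
theorem stub_edgeLayerStability :
    ∀ v : ℝ → ℝ≥0∞, IsRepulsiveFiniteRange v → (∀ r, v r ≠ ⊤) →
      ContDiff ℝ 2 (fun x : Space => (v ‖x‖).toReal) →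
      (∃ Cₑ : ℝ, ∀ x : Space,
        ‖iteratedFDeriv ℝ 2 (fun x : Space => (v ‖x‖).toReal) x‖ ≤ Cₑ * Real.sqrt ((v ‖x‖).toReal)) →
      0 < v 0 →
      ∃ μ : ℝ, 0 < μ ∧ ∃ C : ℝ, 0 ≤ C ∧ ∃ ρ₀ : ℝ, 0 < ρ₀ ∧ ∀ ρ : ℝ, 0 < ρ → ρ < ρ₀ →
        ∀ᶠ n : ℕ in Filter.atTop, ∀ Φ : PeriodicTrialState (n + 1) (sideLength ρ (n + 1)),
          ENNReal.ofReal μ *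
              (∫⁻ X in cellN (n + 1) (sideLength ρ (n + 1)),
                (∑ i : Fin (n + 1), ∑ j : Fin (n + 1) with i < j, ∑' q : Fin 3 → ℤ,
                  ENNReal.ofReal (‖X i - X j - latticeVec (sideLength ρ (n + 1)) q‖ ^ 2 *
                    ‖iteratedFDeriv ℝ 2 (fun y : Space => (v ‖y‖).toReal)
                      (X i - X j - latticeVec (sideLength ρ (n + 1)) q)‖)) *
                  (‖Φ.ψ X‖₊ : ℝ≥0∞) ^ 2) ≤
            periodicEnergy v Φ + ENNReal.ofReal (C * ρ * ((n : ℝ) + 1)) := by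
  sorry

/-- **STUB 2 (size L–XL; shared support of every line on this crux) — `CubicMomentFloor`.**
For a smooth-class `v` there is `c ≥ 0` such that on EVERY torus (`n`, `L > 0`), for every exact
minimiser `Ψ` that is `C³`, real and has finite energy and finite pair moment, and every `m ≠ 0`:
`|k|/√(|k|² + c(E(Ψ)/N + P(Ψ)/N)) ≤ S_m`. Why true (finite `N`, no spectral theorem): with
`A = ρ_k = ∑ⱼe^{ik·xⱼ}`, `B = [H,A]Ψ = ∑ⱼe^{ik·xⱼ}(|k|² − 2ik·∇ⱼ)Ψ ∈ C²` and `q = ` the form of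
`H − E₀ ≥ 0` on symmetric periodic `C¹` functions (minimality): `m₀ = ‖AΨ‖² = N S_m`,
`m₁ = q(AΨ) = ⟨AΨ,B⟩ = N|k|²` (f-sum, real `Ψ`, one integration by parts), `m₂ = ‖B‖² = q(B, AΨ)`,
`m₃ = q(B)`; Cauchy–Schwarz twice (`m₁² ≤ m₀m₂`, `m₂² ≤ m₁m₃`) gives `m₀ ≥ m₁^{3/2}m₃^{-1/2}`; Puff's
evaluation `m₃ ≤ N|k|⁴(|k|² + c T/N + c P/N)` (double commutator, `1 − cos k·x ≤ |k|²|x − Lq|²/2`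
termwise in the periodisation, `|∂²_k̂ṽ| ≤ ‖D²ṽ‖`, `T ≤ E(Ψ)`) — Puff1965; Stringari1995 §2.3
(20)–(23); doi:10.1103/physrevb.46.2974; Feynman1954. EXPLICIT CONSTANTS (re-derived by the gen-2
planner and by triage r1-2/r1-3 G1, `ħ = 2m = 1`, `p = −i∇`): with `[H, e^{ik·x}] =
e^{ik·x}(|k|² + 2k·p)` one gets `½[A†,[H,A]] = N|k|²` and
`m₃ = N|k|⁶ + 12|k|²∑ⱼ⟨(k·pⱼ)²⟩ + 4∑_{i<j}⟨(1 − cos k·xᵢⱼ)(k·∇)²ṽ^per(xᵢⱼ)⟩` EXACTLY (the one-body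
`δ`-term `−4i|k|²⟨k·∑ⱼ∇ⱼV⟩` vanishes by translation invariance of `V`; no three-body terms), so
`m₃ ≤ N|k|⁴(|k|² + 12T/N + 2P/N)` and `c = 12` works for EVERY `v`. Regularity actually consumed:
the f-sum identity needs only `Ψ ∈ C¹` + the WEAK Euler–Lagrange equation tested on `|A|²Ψ`; `B`,
`q(B)` and Puff's evaluation need the pointwise eigen-equation and `Ψ ∈ C²` (form sense) — `C³` is
assumed for comfort (`(H − E₀)B = [H,[H,A]]Ψ` pointwise) and matches `PositiveMinimiser` (11787).
The eigen-equation is derived from minimality + `C²` (Euler–Lagrange with symmetrised test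
functions). Leans on: `cellWave`, `integral_cellN_*` toolkit of
`Theorems/PuffFloor/Negative/PairCorrelationToolkit` (p73350), `fSumIdentity_holds` pattern of
`Cruxes/InfraredMinimumUncertainty/Lines/fisher-gaussian-density-mode.lean`. -/
theorem stub_cubicMomentFloor :
    ∀ v : ℝ → ℝ≥0∞, IsRepulsiveFiniteRange v → (∀ r, v r ≠ ⊤) →
      ContDiff ℝ 2 (fun x : Space => (v ‖x‖).toReal) →
      (∃ Cₑ : ℝ, ∀ x : Space,
        ‖iteratedFDeriv ℝ 2 (fun x : Space => (v ‖x‖).toReal) x‖ ≤ Cₑ * Real.sqrt ((v ‖x‖).toReal)) →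
      ∃ c : ℝ, 0 ≤ c ∧ ∀ (n : ℕ) (L : ℝ), 0 < L → ∀ Ψ : PeriodicTrialState (n + 1) L,
        periodicEnergy v Ψ = periodicGroundStateEnergy v (n + 1) L → periodicEnergy v Ψ ≠ ⊤ →
        ContDiff ℝ 3 Ψ.ψ → (∀ X, Ψ.ψ X = (‖Ψ.ψ X‖ : ℂ)) →
        (∫⁻ X in cellN (n + 1) L,
            (∑ i : Fin (n + 1), ∑ j : Fin (n + 1) with i < j, ∑' q : Fin 3 → ℤ,
              ENNReal.ofReal (‖X i - X j - latticeVec L q‖ ^ 2 *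
                ‖iteratedFDeriv ℝ 2 (fun y : Space => (v ‖y‖).toReal) (X i - X j - latticeVec L q)‖)) *
              (‖Ψ.ψ X‖₊ : ℝ≥0∞) ^ 2) ≠ ⊤ →
        ∀ m : Fin 3 → ℤ, m ≠ 0 →
          ‖((2 * Real.pi / L) • latticeVec 1 m)‖ /
              Real.sqrt (‖((2 * Real.pi / L) • latticeVec 1 m)‖ ^ 2 +
                c * ((periodicEnergy v Ψ).toReal / ((n : ℝ) + 1) +
                  (∫⁻ X in cellN (n + 1) L,
                    (∑ i : Fin (n + 1), ∑ j : Fin (n + 1) with i < j, ∑' q : Fin 3 → ℤ,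
                      ENNReal.ofReal (‖X i - X j - latticeVec L q‖ ^ 2 *
                        ‖iteratedFDeriv ℝ 2 (fun y : Space => (v ‖y‖).toReal)
                          (X i - X j - latticeVec L q)‖)) *
                      (‖Ψ.ψ X‖₊ : ℝ≥0∞) ^ 2).toReal / ((n : ℝ) + 1))) ≤
            ((n : ℝ) + 1)⁻¹ *
              ∫ X in cellN (n + 1) L, ‖∑ j : Fin (n + 1), cellWave L m (X j)‖ ^ 2 * ‖Ψ.ψ X‖ ^ 2 := by
  sorry

/-- **STUB 3 (size M on paper, L–XL in Lean; shared support, also of IMU stmt-11784) —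
`MinimiserRegularity`.** For a smooth-class `v`, every exact minimiser `Ψ` of the periodic
`(n+1)`-body energy in the `C¹` periodic Bose class (finite energy, real, nowhere zero) is `C³`.
Why true: the first variation (symmetrised `C¹` test functions; `Ψ`, `V^per` symmetric) makes `Ψ` a
weak solution of `−ΔΨ = (E₀ − V^per)Ψ` on the torus with `V^per ∈ C²` (locally finite lattice sum of
`C²` functions); interior Schauder theory then gives `C^{2,α}`, then `C^{3,α}` (ReedSimonIV1978
§XIII.12; Gilbarg–Trudinger Thm 4.3 + Thm 6.17). LEAN COST (gen-2 note): neither Schauder nor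
Calderón–Zygmund regularity is in Mathlib, and the Sobolev/Parseval bootstrap on the torus stops at
`H⁴`, which does not embed in `C³` (nor even `C¹`) in dimension `3N ≥ 6` — so the direct proof is
a regularity-theory project. CHEAPEST DISCHARGES: (a) the tenure restatement inserting
`ContDiff ℝ 3 Ψ.ψ →` into `PuffFloor` (and IMU) — free for the route, because `IMUChainGlue` feeds
the crux the `C³` minimiser of `PositiveMinimiser` (triage S2/F2, unanimous) — deletes this stub;
(b) ELEMENTARY uniqueness: given ONE `C¹` exact minimiser `Ψ₀ > 0`, the ground-state transformation
`E(φΨ₀) − E₀‖φΨ₀‖² = ∫Ψ₀²|∇φ|²` (weak Euler–Lagrange tested on `φ²Ψ₀`, one integration by parts;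
needs only `C¹`) forces every exact minimiser to be `cΨ₀`, so this stub follows from
`PositiveMinimiser` (stmt-11787, whose own proof carries the same regularity debt) + an M-sized
uniqueness lemma — the cut chosen by the sibling line `coupling-slope-pocket`
(`stub_positiveMinimiser`, `stub_positiveMinimiserUnique`). Without some form of it the crux hands
the Puff chain a `C¹` state on which `m₃` is undefined. -/
theorem stub_minimiserRegularity :
    ∀ v : ℝ → ℝ≥0∞, IsRepulsiveFiniteRange v → (∀ r, v r ≠ ⊤) →
      ContDiff ℝ 2 (fun x : Space => (v ‖x‖).toReal) →
      (∃ Cₑ : ℝ, ∀ x : Space,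
        ‖iteratedFDeriv ℝ 2 (fun x : Space => (v ‖x‖).toReal) x‖ ≤ Cₑ * Real.sqrt ((v ‖x‖).toReal)) →
      ∀ (n : ℕ) (L : ℝ), 0 < L → ∀ Ψ : PeriodicTrialState (n + 1) L,
        periodicEnergy v Ψ = periodicGroundStateEnergy v (n + 1) L → periodicEnergy v Ψ ≠ ⊤ →
        (∀ X, Ψ.ψ X = (‖Ψ.ψ X‖ : ℂ)) → (∀ X, Ψ.ψ X ≠ 0) → ContDiff ℝ 3 Ψ.ψ := by
  sorry

/-- **STUB 4 (the residual; size XL, no mechanism in this line) — `PairMomentBoundCoreless`.** For the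
CORELESS members of the smooth class (`v 0 = 0`: e.g. `ṽ = A|x|⁴(R₀² − |x|²)₊⁴`, hollow shells,
`v ≡ 0`), the pair moment of the exact minimiser is still `O(ρN)`: `P(Ψ) ≤ CρN` for `ρ < ρ₀`,
eventually in `N`. Why plausibly true: for `v ≥ 0` no Efimov/Thomas clustering; `g₂ ≈ ρ²f₀²` with
`f₀ ≤ 1`, so `P/N ≈ (ρ/2)∫W f₀² ≤ (ρ/2)‖W‖₁`; `v ≡ 0`: `W ≡ 0`, `P = 0`. Why it is the residual: every
ENERGY-comparison lever is void here (`H(v) − μ∑W^per` is unbounded below `∝ −N²`: clusters at the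
origin cost `o(1)`, pairs of clusters at separation in the outer edge layer gain `μW`; triage S1/F1).
Closes either by a minimiser-specific kinetic-localisation / pair-density argument (cf. line
`pair-subsolution-removal-energy`, whose step 7(c) also needs a core) or by the tenure restatement
adding `0 < v 0` to the route's smooth class (HardCoreExtension absorbs coreless `v`). -/
theorem stub_corelessPairMoment :
    ∀ v : ℝ → ℝ≥0∞, IsRepulsiveFiniteRange v → (∀ r, v r ≠ ⊤) →
      ContDiff ℝ 2 (fun x : Space => (v ‖x‖).toReal) →
      (∃ Cₑ : ℝ, ∀ x : Space,
        ‖iteratedFDeriv ℝ 2 (fun x : Space => (v ‖x‖).toReal) x‖ ≤ Cₑ * Real.sqrt ((v ‖x‖).toReal)) →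
      v 0 = 0 →
      ∃ C : ℝ, 0 ≤ C ∧ ∃ ρ₀ : ℝ, 0 < ρ₀ ∧ ∀ ρ : ℝ, 0 < ρ → ρ < ρ₀ → ∀ᶠ n : ℕ in Filter.atTop,
        ∀ Ψ : PeriodicTrialState (n + 1) (sideLength ρ (n + 1)),
          periodicEnergy v Ψ = periodicGroundStateEnergy v (n + 1) (sideLength ρ (n + 1)) →
          periodicEnergy v Ψ ≠ ⊤ → (∀ X, Ψ.ψ X = (‖Ψ.ψ X‖ : ℂ)) → (∀ X, Ψ.ψ X ≠ 0) →
          (∫⁻ X in cellN (n + 1) (sideLength ρ (n + 1)),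
              (∑ i : Fin (n + 1), ∑ j : Fin (n + 1) with i < j, ∑' q : Fin 3 → ℤ,
                ENNReal.ofReal (‖X i - X j - latticeVec (sideLength ρ (n + 1)) q‖ ^ 2 *
                  ‖iteratedFDeriv ℝ 2 (fun y : Space => (v ‖y‖).toReal)
                    (X i - X j - latticeVec (sideLength ρ (n + 1)) q)‖)) *
                (‖Ψ.ψ X‖₊ : ℝ≥0∞) ^ 2) ≤
            ENNReal.ofReal (C * ρ * ((n : ℝ) + 1)) := by
  sorry

/-! ## Certificates: the stubs ARE the named statements, the named crux IS the route decl -/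

theorem edgeLayerStability_iff :
    EdgeLayerStability ↔
    (∀ v : ℝ → ℝ≥0∞, IsRepulsiveFiniteRange v → (∀ r, v r ≠ ⊤) →
      ContDiff ℝ 2 (fun x : Space => (v ‖x‖).toReal) →
      (∃ Cₑ : ℝ, ∀ x : Space,
        ‖iteratedFDeriv ℝ 2 (fun x : Space => (v ‖x‖).toReal) x‖ ≤ Cₑ * Real.sqrt ((v ‖x‖).toReal)) →
      0 < v 0 →
      ∃ μ : ℝ, 0 < μ ∧ ∃ C : ℝ, 0 ≤ C ∧ ∃ ρ₀ : ℝ, 0 < ρ₀ ∧ ∀ ρ : ℝ, 0 < ρ → ρ < ρ₀ →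
        ∀ᶠ n : ℕ in Filter.atTop, ∀ Φ : PeriodicTrialState (n + 1) (sideLength ρ (n + 1)),
          ENNReal.ofReal μ *
              (∫⁻ X in cellN (n + 1) (sideLength ρ (n + 1)),
                (∑ i : Fin (n + 1), ∑ j : Fin (n + 1) with i < j, ∑' q : Fin 3 → ℤ,
                  ENNReal.ofReal (‖X i - X j - latticeVec (sideLength ρ (n + 1)) q‖ ^ 2 *
                    ‖iteratedFDeriv ℝ 2 (fun y : Space => (v ‖y‖).toReal)
                      (X i - X j - latticeVec (sideLength ρ (n + 1)) q)‖)) *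
                  (‖Φ.ψ X‖₊ : ℝ≥0∞) ^ 2) ≤
            periodicEnergy v Φ + ENNReal.ofReal (C * ρ * ((n : ℝ) + 1))) :=
  Iff.rfl

theorem puffFloorNamed_iff :
    PuffFloorNamed ↔
      Summit.AtomisticToContinuum.BoseEinsteinCondensation.Theses.BECConjugateDomination.PuffFloor :=
  Iff.rfl

/-- The four registered stubs, read as the named statements (type ascription = certificate). -/
theorem edgeLayerStability : EdgeLayerStability := stub_edgeLayerStability
theorem cubicMomentFloor : CubicMomentFloor := stub_cubicMomentFloor
theorem minimiserRegularity : MinimiserRegularity := stub_minimiserRegularity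
theorem pairMomentBoundCoreless : PairMomentBoundCoreless := stub_corelessPairMoment

/-! ## Proved: `E₀^per(N, L) ≤ (N²/L³) ∫ṽ` (constant trial state) -/

section EnergyUpperBound

variable {v : ℝ → ℝ≥0∞}

private theorem measurable_periodizedPotential' (hv : Measurable v) (L : ℝ) :
    Measurable (periodizedPotential v L) := by
  unfold periodizedPotential
  exact Measurable.tsum fun n => hv.comp (measurable_id.sub_const _).norm

/-- `∫_{cell^{n+1}} v^per(xᵢ - xⱼ) dX = (∫_{ℝ³} v(|x|)dx) · L^{3n}` for `i ≠ j` (slice integration in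
`xᵢ`, unfolding of the periodisation on the cell). [folklore] -/
theorem lintegral_cellN_periodizedPotential_pair (hv : Measurable v) {L : ℝ} (hL : 0 < L) {n : ℕ}
    {i j : Fin (n + 1)} (hij : i ≠ j) :
    ∫⁻ X in cellN (n + 1) L, periodizedPotential v L (X i - X j) =
      (∫⁻ x : Space, v ‖x‖) * (ENNReal.ofReal L ^ 3) ^ n := by
  have hH : Measurable fun X : Config (n + 1) => periodizedPotential v L (X i - X j) :=
    (measurable_periodizedPotential' hv L).comp ((measurable_pi_apply i).sub (measurable_pi_apply j))
  have key := lintegral_cellN_lintegral_update (L := L) i hH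
  have hinner : ∀ X : Config (n + 1),
      (∫⁻ x in cell L, periodizedPotential v L (Function.update X i x i - Function.update X i x j)) =
        ∫⁻ y : Space, v ‖y‖ := by
    intro X
    simp only [Function.update_self, Function.update_of_ne hij.symm]
    exact lintegral_cell_periodizedPotential_sub hL hv (X j)
  simp only [hinner] at key
  rw [setLIntegral_const, volume_cellN, pow_succ, ← mul_assoc] at key
  have hV0 : (ENNReal.ofReal L ^ 3) ≠ 0 := pow_ne_zero _ ((ENNReal.ofReal_pos.2 hL).ne')
  have hVt : (ENNReal.ofReal L ^ 3) ≠ ⊤ := ENNReal.pow_ne_top ENNReal.ofReal_ne_top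
  have key' : (ENNReal.ofReal L ^ 3) * ((∫⁻ y : Space, v ‖y‖) * (ENNReal.ofReal L ^ 3) ^ n) =
      (ENNReal.ofReal L ^ 3) * ∫⁻ X in cellN (n + 1) L, periodizedPotential v L (X i - X j) := by
    rw [← key]; ring
  exact ((ENNReal.mul_right_inj hV0 hVt).1 key').symm

/-- **`E₀^per(n+1, L) ≤ ((n+1)²/L³) ∫_{ℝ³} v(|x|)dx`** by the constant trial state `Φ ≡ L^{-3(n+1)/2}`
(zero kinetic energy; each of the `≤ (n+1)²` pair terms costs `L⁻³∫ṽ`). [folklore] -/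
theorem periodicGroundStateEnergy_le_const (hv : Measurable v) (n : ℕ) {L : ℝ} (hL : 0 < L) :
    periodicGroundStateEnergy v (n + 1) L ≤
      ENNReal.ofReal (((n : ℝ) + 1) ^ 2 / L ^ 3) * ∫⁻ x : Space, v ‖x‖ := by
  set A : ℝ := (L ^ 3) ^ (n + 1) with hA
  have hLne : L ≠ 0 := hL.ne'
  have hL3 : 0 < L ^ 3 := by positivity
  have hApos : 0 < A := by positivity
  set c : ℝ := (Real.sqrt A)⁻¹ with hcdef
  have hc : ((‖(c : ℂ)‖₊ : ℝ≥0∞) ^ 2) = ENNReal.ofReal A⁻¹ := by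
    rw [← ENNReal.coe_pow, ENNReal.ofReal, ENNReal.coe_inj]
    ext
    rw [NNReal.coe_pow, coe_nnnorm, Complex.norm_real, hcdef, norm_inv,
      Real.norm_of_nonneg (Real.sqrt_nonneg _), inv_pow, Real.sq_sqrt hApos.le,
      Real.coe_toNNReal _ (by positivity)]
  have hvolA : (ENNReal.ofReal L ^ 3) ^ (n + 1) = ENNReal.ofReal A := by
    rw [hA, ← ENNReal.ofReal_pow hL.le, ← ENNReal.ofReal_pow hL3.le]
  let Φ : PeriodicTrialState (n + 1) L :=
    { ψ := fun _ => (c : ℂ)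
      contDiff := contDiff_const
      periodic := fun _ _ _ => rfl
      symm := fun _ _ => rfl
      norm_eq := by
        rw [setLIntegral_const, volume_cellN, hc, hvolA, ← ENNReal.ofReal_mul (inv_nonneg.2 hApos.le),
          inv_mul_cancel₀ hApos.ne', ENNReal.ofReal_one] }
  refine (periodicGroundStateEnergy_le v Φ).trans ?_
  -- the energy of the constant state
  have hkin : ∀ X : Config (n + 1), kineticDensity (fun _ : Config (n + 1) => (c : ℂ)) X = 0 := by
    intro X
    simp [kineticDensity]
  have hE : periodicEnergy v Φ =
      (∫⁻ X in cellN (n + 1) L, periodicInteraction v L X) * ENNReal.ofReal A⁻¹ := by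
    unfold periodicEnergy
    rw [← lintegral_mul_const' _ _ ENNReal.ofReal_ne_top]
    refine lintegral_congr fun X => ?_
    change kineticDensity (fun _ : Config (n + 1) => (c : ℂ)) X +
        periodicInteraction v L X * ((‖(c : ℂ)‖₊ : ℝ≥0∞) ^ 2) = _
    rw [hkin, zero_add, hc]
  -- the interaction integral: at most (n+1)² pair terms, each `∫ṽ · L^{3n}`
  set I : ℝ≥0∞ := ∫⁻ x : Space, v ‖x‖ with hI
  set V : ℝ≥0∞ := ENNReal.ofReal L ^ 3 with hV
  have hpair : ∀ i j : Fin (n + 1), i ≠ j →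
      ∫⁻ X in cellN (n + 1) L, periodizedPotential v L (X i - X j) = I * V ^ n :=
    fun i j hij => lintegral_cellN_periodizedPotential_pair hv hL hij
  have hmeas : ∀ i j : Fin (n + 1),
      Measurable fun X : Config (n + 1) => periodizedPotential v L (X i - X j) := fun i j =>
    (measurable_periodizedPotential' hv L).comp ((measurable_pi_apply i).sub (measurable_pi_apply j))
  have hint : (∫⁻ X in cellN (n + 1) L, periodicInteraction v L X) ≤
      ((n + 1 : ℕ) : ℝ≥0∞) * (((n + 1 : ℕ) : ℝ≥0∞) * (I * V ^ n)) := by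
    unfold periodicInteraction
    rw [lintegral_finsetSum _ fun i _ => Finset.measurable_sum _ fun j _ => hmeas i j]
    have hrow : ∀ i : Fin (n + 1),
        (∫⁻ X in cellN (n + 1) L, ∑ j : Fin (n + 1) with i < j, periodizedPotential v L (X i - X j)) ≤
          ((n + 1 : ℕ) : ℝ≥0∞) * (I * V ^ n) := by
      intro i
      rw [lintegral_finsetSum _ fun j _ => hmeas i j]
      have hterm : ∀ j ∈ (Finset.univ.filter fun j : Fin (n + 1) => i < j),
          (∫⁻ X in cellN (n + 1) L, periodizedPotential v L (X i - X j)) = I * V ^ n := by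
        intro j hj
        exact hpair i j (Finset.mem_filter.1 hj).2.ne
      rw [Finset.sum_congr rfl hterm, Finset.sum_const, nsmul_eq_mul]
      gcongr
      exact_mod_cast (Finset.card_filter_le _ _).trans (by simp)
    calc (∑ i : Fin (n + 1), ∫⁻ X in cellN (n + 1) L,
            ∑ j : Fin (n + 1) with i < j, periodizedPotential v L (X i - X j))
        ≤ ∑ _i : Fin (n + 1), ((n + 1 : ℕ) : ℝ≥0∞) * (I * V ^ n) := Finset.sum_le_sum fun i _ => hrow i
      _ = ((n + 1 : ℕ) : ℝ≥0∞) * (((n + 1 : ℕ) : ℝ≥0∞) * (I * V ^ n)) := by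
          rw [Finset.sum_const, nsmul_eq_mul, Finset.card_univ, Fintype.card_fin]
  rw [hE]
  calc (∫⁻ X in cellN (n + 1) L, periodicInteraction v L X) * ENNReal.ofReal A⁻¹
      ≤ ((n + 1 : ℕ) : ℝ≥0∞) * (((n + 1 : ℕ) : ℝ≥0∞) * (I * V ^ n)) * ENNReal.ofReal A⁻¹ :=
        mul_le_mul' hint le_rfl
    _ = (((n + 1 : ℕ) : ℝ≥0∞) * ((n + 1 : ℕ) : ℝ≥0∞) * (V ^ n * ENNReal.ofReal A⁻¹)) * I := by ring
    _ = ENNReal.ofReal (((n : ℝ) + 1) ^ 2 / L ^ 3) * I := by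
        congr 1
        rw [hV, ← ENNReal.ofReal_pow hL.le, ← ENNReal.ofReal_pow hL3.le,
          ← ENNReal.ofReal_mul (by positivity), ← ENNReal.ofReal_natCast,
          ← ENNReal.ofReal_mul (by positivity), ← ENNReal.ofReal_mul (by positivity)]
        congr 1
        rw [hA]
        push_cast
        field_simp
        ring

/-- Along the thermodynamic sequence `L = (N/ρ)^{1/3}`: **`E₀^per ≤ ρ N ∫ṽ`**. [folklore] -/
theorem periodicGroundStateEnergy_sideLength_le (hv : Measurable v) {ρ : ℝ} (hρ : 0 < ρ) (n : ℕ) :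
    periodicGroundStateEnergy v (n + 1) (sideLength ρ (n + 1)) ≤
      ENNReal.ofReal (ρ * ((n : ℝ) + 1)) * ∫⁻ x : Space, v ‖x‖ := by
  have hL : 0 < sideLength ρ (n + 1) := sideLength_pos_of_pos hρ (Nat.succ_pos n)
  have hN : (n : ℝ) + 1 ≠ 0 := by positivity
  have hρne : ρ ≠ 0 := hρ.ne'
  refine (periodicGroundStateEnergy_le_const hv n hL).trans (le_of_eq ?_)
  congr 2
  rw [sideLength_pow_three hρ (n + 1)]
  push_cast
  field_simp

/-- For a finite smooth potential of finite range, `∫_{ℝ³} v(|x|) dx < ∞`. [folklore] -/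
theorem lintegral_lt_top_of_smooth (hv : IsRepulsiveFiniteRange v) (hfin : ∀ r, v r ≠ ⊤)
    (hC : ContDiff ℝ 2 (fun x : Space => (v ‖x‖).toReal)) : (∫⁻ x : Space, v ‖x‖) < ⊤ := by
  obtain ⟨R₀, hR₀⟩ := hv.2
  set f : Space → ℝ := fun x => (v ‖x‖).toReal with hf
  have hfc : Continuous f := hC.continuous
  have hfs : HasCompactSupport f := by
    refine HasCompactSupport.intro (isCompact_closedBall (0 : Space) R₀) fun x hx => ?_
    have hx' : R₀ < ‖x‖ := by
      rw [mem_closedBall, dist_zero_right] at hx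
      exact lt_of_not_ge hx
    simp [hf, hR₀ _ hx']
  have hint : Integrable f volume := hfc.integrable_of_hasCompactSupport hfs
  have h0 : ∀ x, 0 ≤ f x := fun x => ENNReal.toReal_nonneg
  calc (∫⁻ x : Space, v ‖x‖) = ∫⁻ x : Space, ‖f x‖ₑ := by
        refine lintegral_congr fun x => ?_
        rw [Real.enorm_eq_ofReal (h0 x)]
        simp only [hf]
        rw [ENNReal.ofReal_toReal (hfin _)]
    _ < ⊤ := hint.2

end EnergyUpperBound

/-! ## `ρ`-free domination ⇒ STUB 1 (sorry-free; for a stub worker proving the Lee form) -/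

/-- Lee's `ρ`-free form implies the registered stub with `C = 0`, `ρ₀ = 1`: along `L = (N/ρ)^{1/3}`
the torus is eventually larger than `L₀`. -/
theorem edgeLayerStability_of_domination (h : EdgeLayerDomination) : EdgeLayerStability := by
  intro v hv₁ hv₂ hv₃ hv₄ hcore
  obtain ⟨μ, hμ, L₀, hdom⟩ := h v hv₁ hv₂ hv₃ hv₄ hcore
  refine ⟨μ, hμ, 0, le_rfl, 1, one_pos, fun ρ hρ _ => ?_⟩
  have hev : ∀ᶠ n : ℕ in atTop, L₀ ≤ sideLength ρ (n + 1) :=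
    ((tendsto_sideLength_atTop hρ).comp (tendsto_add_atTop_nat 1)).eventually_ge_atTop L₀
  filter_upwards [hev] with n hn Φ
  exact le_add_right (hdom (n + 1) _ hn Φ)

/-! ## The lever: one-sided Hellmann–Feynman chord (sorry-free glue) -/

/-- **`EdgeLayerStability ⇒ PairMomentBoundSolid`** — apply the stability form to the minimiser
itself: `μ P(Ψ) ≤ E(Ψ) + CρN = E₀ + CρN ≤ (∫ṽ + C) ρ N`, so `P(Ψ) ≤ ((∫ṽ + C)/μ) ρ N`.
(First-order perturbation theory made one-sided and exact by the variational principle; this is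
where exact minimality enters, cf. `puffFloor_false_without_minimality`.) -/
theorem pairMomentBoundSolid_of (hS : EdgeLayerStability) : PairMomentBoundSolid := by
  intro v hv₁ hv₂ hv₃ hv₄ hcore
  obtain ⟨μ, hμ, C, hC, ρ₀, hρ₀, h⟩ := hS v hv₁ hv₂ hv₃ hv₄ hcore
  have hItop : (∫⁻ x : Space, v ‖x‖) ≠ ⊤ := (lintegral_lt_top_of_smooth hv₁ hv₂ hv₃).ne
  set I : ℝ := (∫⁻ x : Space, v ‖x‖).toReal with hI
  have hI0 : 0 ≤ I := ENNReal.toReal_nonneg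
  refine ⟨(I + C) / μ, by positivity, ρ₀, hρ₀, fun ρ hρ hρlt => ?_⟩
  filter_upwards [h ρ hρ hρlt] with n hn Ψ hE _hfin _hreal _hpos
  have hN : (0 : ℝ) < (n : ℝ) + 1 := by positivity
  have hE₀ : periodicEnergy v Ψ ≤ ENNReal.ofReal (I * (ρ * ((n : ℝ) + 1))) := by
    rw [hE]
    refine (periodicGroundStateEnergy_sideLength_le hv₁.1 hρ n).trans (le_of_eq ?_)
    rw [← ENNReal.ofReal_toReal hItop, ← hI, ← ENNReal.ofReal_mul (by positivity)]
    congr 1; ring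
  have hkey : ENNReal.ofReal μ * pairMoment v (n + 1) (sideLength ρ (n + 1)) Ψ.ψ ≤
      ENNReal.ofReal ((I + C) * ρ * ((n : ℝ) + 1)) := by
    refine (hn Ψ).trans ?_
    refine (add_le_add hE₀ le_rfl).trans (le_of_eq ?_)
    rw [← ENNReal.ofReal_add (by positivity) (by positivity)]
    congr 1; ring
  have hμ' : ENNReal.ofReal μ ≠ 0 := (ENNReal.ofReal_pos.2 hμ).ne'
  calc pairMoment v (n + 1) (sideLength ρ (n + 1)) Ψ.ψ
      ≤ ENNReal.ofReal ((I + C) * ρ * ((n : ℝ) + 1)) / ENNReal.ofReal μ := by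
        rw [ENNReal.le_div_iff_mul_le (Or.inl hμ') (Or.inl ENNReal.ofReal_ne_top)]
        exact (mul_comm _ _).trans_le hkey
    _ = ENNReal.ofReal ((I + C) / μ * ρ * ((n : ℝ) + 1)) := by
        rw [← ENNReal.ofReal_div_of_pos hμ]
        congr 1
        ring

/-- Solid cores by the lever, coreless members by the residual stub: the pair-moment node for the
WHOLE smooth class (case split on `0 < v 0`). -/
theorem pairMomentBound_of (hS : PairMomentBoundSolid) (hC : PairMomentBoundCoreless) :
    PairMomentBound := by
  intro v hv₁ hv₂ hv₃ hv₄
  rcases eq_zero_or_pos (v 0) with h0 | h0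
  · exact hC v hv₁ hv₂ hv₃ hv₄ h0
  · exact hS v hv₁ hv₂ hv₃ hv₄ h0

/-! ## Composition over the named objects -/

/-- `a/√(a² + y) ≤ a/√(a² + x)` for `0 ≤ a`, `0 ≤ x ≤ y`. -/
theorem floor_antitone {a x y : ℝ} (ha : 0 ≤ a) (hx : 0 ≤ x) (hxy : x ≤ y) :
    a / Real.sqrt (a ^ 2 + y) ≤ a / Real.sqrt (a ^ 2 + x) := by
  rcases ha.eq_or_lt with rfl | ha'
  · simp
  · exact div_le_div_of_nonneg_left ha (Real.sqrt_pos.2 (by positivity))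
      (Real.sqrt_le_sqrt (by linarith))

/-- **The line**: cubic-moment floor + regularity + pair-moment node ⇒ the crux (named form), with
`C := c (∫ṽ + C_P)` and `ρ₀ := ρ_P`; the energy per particle is `≤ ρ∫ṽ` by the constant state. -/
theorem puffFloorNamed_of (hM : CubicMomentFloor) (hR : MinimiserRegularity) (hP : PairMomentBound) :
    PuffFloorNamed := by
  intro v hv₁ hv₂ hv₃ hv₄
  obtain ⟨c, hc, hfloor⟩ := hM v hv₁ hv₂ hv₃ hv₄
  obtain ⟨C, hC, ρ₀, hρ₀, hpair⟩ := hP v hv₁ hv₂ hv₃ hv₄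
  have hItop : (∫⁻ x : Space, v ‖x‖) ≠ ⊤ := (lintegral_lt_top_of_smooth hv₁ hv₂ hv₃).ne
  set I : ℝ := (∫⁻ x : Space, v ‖x‖).toReal with hI
  have hI0 : 0 ≤ I := ENNReal.toReal_nonneg
  refine ⟨c * (I + C), by positivity, ρ₀, hρ₀, fun ρ hρ hρlt => ?_⟩
  filter_upwards [hpair ρ hρ hρlt] with n hn Ψ hE hfin hreal hpos m hm
  have hL : 0 < sideLength ρ (n + 1) := sideLength_pos_of_pos hρ (Nat.succ_pos n)
  have hN : (0 : ℝ) < (n : ℝ) + 1 := by positivity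
  have hreg : ContDiff ℝ 3 Ψ.ψ := hR v hv₁ hv₂ hv₃ hv₄ n _ hL Ψ hE hfin hreal hpos
  have hPle := hn Ψ hE hfin hreal hpos
  have hPtop : pairMoment v (n + 1) (sideLength ρ (n + 1)) Ψ.ψ ≠ ⊤ :=
    ne_top_of_le_ne_top ENNReal.ofReal_ne_top hPle
  have key := hfloor n _ hL Ψ hE hfin hreg hreal hPtop m hm
  refine le_trans (floor_antitone (norm_nonneg _) (by positivity) ?_) key
  -- `c (E/N + P/N) ≤ c (∫ṽ + C) ρ`
  have hE' : (periodicEnergy v Ψ).toReal / ((n : ℝ) + 1) ≤ I * ρ := by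
    rw [div_le_iff₀ hN]
    refine ENNReal.toReal_le_of_le_ofReal (by positivity) ?_
    rw [hE]
    refine (periodicGroundStateEnergy_sideLength_le hv₁.1 hρ n).trans (le_of_eq ?_)
    rw [← ENNReal.ofReal_toReal hItop, ← hI, ← ENNReal.ofReal_mul (by positivity)]
    congr 1; ring
  have hP' : (pairMoment v (n + 1) (sideLength ρ (n + 1)) Ψ.ψ).toReal / ((n : ℝ) + 1) ≤ C * ρ := by
    rw [div_le_iff₀ hN]
    exact ENNReal.toReal_le_of_le_ofReal (by positivity) hPle
  calc c * ((periodicEnergy v Ψ).toReal / ((n : ℝ) + 1) +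
          (pairMoment v (n + 1) (sideLength ρ (n + 1)) Ψ.ψ).toReal / ((n : ℝ) + 1))
      ≤ c * (I * ρ + C * ρ) := mul_le_mul_of_nonneg_left (add_le_add hE' hP') hc
    _ = c * (I + C) * ρ := by ring

/-! ## The skeleton concludes the crux BY NAME -/

/-- **`PuffFloor`** (route `BECConjugateDomination`, stmt-AtomisticToContinuum-11785) from the four
registered stubs — the ONLY theorem of this file concluding the route decl by name. -/
theorem PuffFloor_of :
    Summit.AtomisticToContinuum.BoseEinsteinCondensation.Theses.BECConjugateDomination.PuffFloor :=
  puffFloorNamed_iff.mp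
    (puffFloorNamed_of cubicMomentFloor minimiserRegularity
      (pairMomentBound_of (pairMomentBoundSolid_of edgeLayerStability) pairMomentBoundCoreless))

end Summit.AtomisticToContinuum.BoseEinsteinCondensation.Cruxes.PuffFloor.SacrificialEdgeLayer

end
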